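import Summits.BirchSwinnertonDyer.BirchSwinnertonDyer.Theorems.PrintCf2DisegniPairTwoLawSocket
import Summits.BirchSwinnertonDyer.BirchSwinnertonDyer.Theorems.PrintCf2DisegniPairTwoLawRigidityClasses
import HarnessLib

/-!
# Road (C) `disegni-pair-two` on crux stmt-BirchSwinnertonDyer-20368 — the crux from the twelve primary prints and the
# EXISTENTIAL (Δ1) law (one datum per member)

Cell `bsd-print-cf2`, width seat `bsd-line-cf2-p1-w8` (g30), `--supports stmt-BirchSwinnertonDyer-20368` (helper). THEOREMS ONLY (no
`def`, no named fact introduced, no `sorry`). The LEAD g25 law socket `splitBadTwoRankOneOfFacts_of_printStubs_of_lawDescent_two`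
(«20368 ⟸ 12 primary prints + (Δ1)») composed with the rigidity theorem `lawDescent_two_of_forall_exists` («(Δ1) ⟸ (Δ1 at one
datum per `7`-free member)», `PrintCf2DisegniPairTwoLawRigidityClasses.lean`). READING UNCHANGED: 20368 = 12 primary prints + (Δ1);
the existential form is equivalent to (Δ1) (the sibling `PrintCf2DisegniPairTwoLawOfExists.lean` states the same reduction for the
route-A support item stmt-BirchSwinnertonDyer-28322 BY NAME, outside the `LawSocket` cone); nothing here proves (Δ1), 28322 or the crux;
BSD is not proved by any of this.

References: D. Disegni, Compos. Math. 153 (2017) Thm. B [Disegni2017]; J. Coates, Y. Li, Y. Tian, S. Zhai, Proc. LMS 110 (2015)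
Thm. 1.2 [CoatesLiTianZhai2015]; B. Mazur, J. Tate, J. Teitelbaum (1986) §I.14 [MazurTateTeitelbaum1986Invent].
-/

set_option autoImplicit false
set_option linter.dupNamespace false

noncomputable section

open scoped Classical MatrixGroups ModularForm NumberField

open CongruenceSubgroup WeierstrassCurve Literature.NumberTheory.EllipticCurves
  Literature.NumberTheory.EllipticCurves.ModularForms
  Literature.NumberTheory.EllipticCurves.CaiShuTian2014 Literature.NumberTheory.EllipticCurves.CoatesLiTianZhai2015

namespace Summit.BirchSwinnertonDyer.BirchSwinnertonDyer.Theorems.PrintCf2.DisegniPairTwo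

/-- ★ **THE CRUX BY NAME from the two print stubs and the EXISTENTIAL (Δ1) law** — `PrintCf2.SplitBadTwoRankOneOfFacts` from S0′
`stub_prints_two` (verbatim), S0″ `stub_anchorPrints_two` (verbatim) and the existential form of (Δ1) (one datum per `7`-free member, one
class function `e_D`), through `lawDescent_two_of_forall_exists` and the LEAD g25 law socket
`splitBadTwoRankOneOfFacts_of_printStubs_of_lawDescent_two`. So «20368 ⟸ 12 primary prints + (Δ1 at one datum per member)».
20368 is not closed by it (every antecedent is a cited print or the research law). [cite: Disegni2017, Thm B]
[cite: CoatesLiTianZhai2015, Thm. 1.2] [cite: MazurTateTeitelbaum1986Invent, §I.14] -/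
theorem splitBadTwoRankOneOfFacts_of_printStubs_of_forall_exists
    (hprints :
      bsdTriple_of_rank_le_one_of_conductor_lt ∧
      Disegni2017.thmB_chi_quadraticBaseChange ∧
      bertrand_pairingSqMinusTwist_self_ne_zero_two ∧
      friedbergHoffstein_exists_heegnerField_split_twist_ne_zero ∧
      ModularForms.nonempty_modularParametrizationData)
    (hanchor :
      CaiShuTian2014.thm11_ringClassChar ∧
      CoatesLiTianZhai2015.thm12_fullBSD_twist ∧
      CoatesLiTianZhai2015.thm44_ord_two_LAlg ∧
      CoatesLiTianZhai2015.thm14_rankOne_twist ∧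
      ModularForms.OptimalCurveManinCertificate cm7 ∧
      x049_x_sub_two_eq_etaQuotient ∧
      deuring_etaQuotient49_heegner_generates_conjPrime)
    (hex : ∃ e_D : ℤ → ℤ → ℤ,
      (∀ (d' : ℤ), d' % 4 = 1 → Squarefree d' → ¬ (7 : ℤ) ∣ d' →
        ∀ (W : WeierstrassCurve ℚ) [W.IsElliptic] [W.IsGloballyMinimal] (C₀ : VariableChange ℚ),
          C₀ • W = cm7.quadraticTwist (((2 * d' : ℤ)) : ℚ) → W.analyticRank = 1 →
        ∃ (V : WeierstrassCurve ℚ) (_ : V.IsElliptic) (_ : V.IsGloballyMinimal) (C₁ : VariableChange ℚ),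
          C₁ • V = cm7.quadraticTwist (d' : ℚ) ∧
        ∃ (N : ℕ) (_ : NeZero N) (f : CuspForm (Gamma0 N) 2), IsNewformOf V f ∧
        ∃ (ϖ : ℚ), ϖ ≠ 0 ∧ (ϖ : ℝ) * V.realPeriodRat = plusPeriod f ∧
        ∃ (_ : (V.quadraticTwist 2).IsElliptic) (C : VariableChange ℚ), C • W = V.quadraticTwist 2 ∧
        ∃ (P : (V.quadraticTwist 2).toAffine.Point), ¬ IsOfFinAddOrder P ∧
          (∀ R : (V.quadraticTwist 2).toAffine.Point,
            ∃ (k : ℤ) (T : (V.quadraticTwist 2).toAffine.Point), IsOfFinAddOrder T ∧ R = k • P + T) ∧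
        ∃ (Dc : PAdicHeightData (V.quadraticTwist 2) 2), Dc.IsCanonicalSqMinusTwist ∧
          (∑' k : ℕ, PowerSeries.coeff k (padicLFunction f (unitRoot V 2 : ℚ_[2])) * (k : ℚ_[2]) *
              (-2) ^ (k - 1)).valuation + padicValRat 2 ϖ - (Dc.pairing P P).valuation =
            (padicValNat 2 (Nat.card (AddCommGroup.primaryComponent W.sha 2)) : ℤ) +
              (padicValNat 2 W.tamagawaProduct : ℤ) - 2 * (padicValNat 2 W.torsionOrder : ℤ) + e_D 0 (d' % 8)) ∧
      (∀ (d' : ℤ), d' % 4 = 1 → Squarefree d' → ¬ (7 : ℤ) ∣ d' →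
        ∀ (W : WeierstrassCurve ℚ) [W.IsElliptic] [W.IsGloballyMinimal] (C₀ : VariableChange ℚ),
          C₀ • W = cm7.quadraticTwist (((-d' : ℤ)) : ℚ) → W.analyticRank = 1 →
        ∃ (V : WeierstrassCurve ℚ) (_ : V.IsElliptic) (_ : V.IsGloballyMinimal) (C₁ : VariableChange ℚ),
          C₁ • V = cm7.quadraticTwist (d' : ℚ) ∧
        ∃ (N : ℕ) (_ : NeZero N) (f : CuspForm (Gamma0 N) 2), IsNewformOf V f ∧
        ∃ (μ : ℚ), μ ≠ 0 ∧ (μ : ℝ) * V.imaginaryPeriodRat = minusPeriod f ∧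
        ∃ (_ : (V.quadraticTwist (-1)).IsElliptic) (C : VariableChange ℚ), C • W = V.quadraticTwist (-1) ∧
        ∃ (P : (V.quadraticTwist (-1)).toAffine.Point), ¬ IsOfFinAddOrder P ∧
          (∀ R : (V.quadraticTwist (-1)).toAffine.Point,
            ∃ (k : ℤ) (T : (V.quadraticTwist (-1)).toAffine.Point), IsOfFinAddOrder T ∧ R = k • P + T) ∧
        ∃ (Dc : PAdicHeightData (V.quadraticTwist (-1)) 2), Dc.IsCanonicalSqMinusTwist ∧
          (PowerSeries.coeff 1 (padicLFunctionMinusBranch f (unitRoot V 2 : ℚ_[2]) 1)).valuation + padicValRat 2 μ - (Dc.pairing P P).valuation =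
            (padicValNat 2 (Nat.card (AddCommGroup.primaryComponent W.sha 2)) : ℤ) +
              (padicValNat 2 W.tamagawaProduct : ℤ) - 2 * (padicValNat 2 W.torsionOrder : ℤ) + e_D 1 ((-d') % 8)) ∧
      (∀ (d' : ℤ), d' % 4 = 1 → Squarefree d' → ¬ (7 : ℤ) ∣ d' →
        ∀ (W : WeierstrassCurve ℚ) [W.IsElliptic] [W.IsGloballyMinimal] (C₀ : VariableChange ℚ),
          C₀ • W = cm7.quadraticTwist (((-2 * d' : ℤ)) : ℚ) → W.analyticRank = 1 →
        ∃ (V : WeierstrassCurve ℚ) (_ : V.IsElliptic) (_ : V.IsGloballyMinimal) (C₁ : VariableChange ℚ),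
          C₁ • V = cm7.quadraticTwist (d' : ℚ) ∧
        ∃ (N : ℕ) (_ : NeZero N) (f : CuspForm (Gamma0 N) 2), IsNewformOf V f ∧
        ∃ (μ : ℚ), μ ≠ 0 ∧ (μ : ℝ) * V.imaginaryPeriodRat = minusPeriod f ∧
        ∃ (_ : (V.quadraticTwist (-2)).IsElliptic) (C : VariableChange ℚ), C • W = V.quadraticTwist (-2) ∧
        ∃ (P : (V.quadraticTwist (-2)).toAffine.Point), ¬ IsOfFinAddOrder P ∧
          (∀ R : (V.quadraticTwist (-2)).toAffine.Point,
            ∃ (k : ℤ) (T : (V.quadraticTwist (-2)).toAffine.Point), IsOfFinAddOrder T ∧ R = k • P + T) ∧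
        ∃ (Dc : PAdicHeightData (V.quadraticTwist (-2)) 2), Dc.IsCanonicalSqMinusTwist ∧
          (∑' k : ℕ, PowerSeries.coeff k (padicLFunctionMinusBranch f (unitRoot V 2 : ℚ_[2]) 1) * (k : ℚ_[2]) *
              (-2) ^ (k - 1)).valuation + padicValRat 2 μ - (Dc.pairing P P).valuation =
            (padicValNat 2 (Nat.card (AddCommGroup.primaryComponent W.sha 2)) : ℤ) +
              (padicValNat 2 W.tamagawaProduct : ℤ) - 2 * (padicValNat 2 W.torsionOrder : ℤ) + e_D 0 ((-d') % 8))) :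
    Summit.BirchSwinnertonDyer.BirchSwinnertonDyer.Theses.PrintCf2.SplitBadTwoRankOneOfFacts :=
  splitBadTwoRankOneOfFacts_of_printStubs_of_lawDescent_two hprints hanchor (lawDescent_two_of_forall_exists hex)

end Summit.BirchSwinnertonDyer.BirchSwinnertonDyer.Theorems.PrintCf2.DisegniPairTwo

end
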